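import Literature.NumberTheory.EllipticCurves.Rank1Residual.PPartGoodOrdinarySurj
import Literature.NumberTheory.EllipticCurves.Rank1Residual.Typed.Basic
import Literature.NumberTheory.EllipticCurves.Skinner2016.RankZeroPPart
import HarnessLib

/-!
# FIELD 3 of line `tame_roads_mult` v3 (crux `AdditiveBranchIMC.MultLower`, stmt-BirchSwinnertonDyer-19359,
# route K1 `AdditiveBranchIMC`): the multiplicative rank-zero partner's `p`-part from Skinner 2016 Thm. C,
# FACTS EXPLICIT — the core of stub `stub_partnerLowerSkinner` (stub-worker `bsd-line-addord-w3` under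
# LEAD `cruxlead-stmt-BirchSwinnertonDyer-19357`; `--supports stmt-BirchSwinnertonDyer-19359 --as helper`)

HONEST FRAMING. Three glue theorems over tree material; no definition, no named fact, no `sorry`; BSD is
proved for no curve here and the crux item stays OPEN. The registered stub `stub_partnerLowerSkinner`
(skeleton v3 06f14dad4cfd) asks, from the line's cite-only conjunction `PrintedFactsM`, for the LOWER
half `MissingLowerBoundAt A p` of the partner `A` (analytic rank `0`, `p ≥ 5`, `A` multiplicative at
`p`, `ρ̄_{A,p}` onto, a multiplicative `ℓ ≠ p` with `p ∤ v_ℓ(Δ_min)`). This file proves that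
conclusion — and the whole `p`-part `MissingPPartAt A p` — at every `p ≥ 3` that is good ordinary OR
multiplicative for `A`, with `A[p]` irreducible, from the THREE conjuncts of `PrintedFactsM` it uses,
taken as explicit named-fact hypotheses: `Skinner2016.thmC_padicValRat_bsd_rank_zero` (Skinner,
Pacific J. Math. 283 (2016), Thm. C: no surjectivity needed), modularity `hasEntireLFunction_rat`
(`L(A,1) ≠ 0` in analytic rank `0`) and Gross–Zagier–Kolyvagin
`rank_eq_analyticRank_of_analyticRank_le_one` (`rank = 0`, `Ш(A)` finite). The by-name form
`stub_partnerLowerSkinner : PrintedFactsM → …` is the sibling file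
`AdditiveBranchIMCMultLowerPartnerLowerSkinner.lean` (one line over this one).

PROOF. Thm. C's print shape is the cell's `PPartRankZero A p` verbatim; `bsdp_of_pPartRankZero`
(torsion term carried) gives Miller's `BSDp A p`; then the typed bookkeeping
`Typed.missingPPartAt_of_bsdp` (`ord_p #Ш(p) = ord_p #Ш` for finite `Ш`) and
`Typed.lower_and_upper_of_missingPPartAt`. Compare `Rank1Residual.bsdp_three_of_L_one_ne_zero_of_ram`
(the same at `p = 3`) and `Summit.BirchSwinnertonDyer.Rank1Residual.RowC1.bsdp` (row form).

References (locators only): [cite: Skinner2016PacificMC, Thm. C (§1), footnote 1, §2.5]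
[cite: Miller2011LMS, Def. 1.1 (arXiv:1010.2431 p. 3)]. presearch: n/a (assembly of tree theorems).
Axioms: `propext`, `Classical.choice`, `Quot.sound`.
-/

set_option autoImplicit false
-- D-0017: single-problem summit, so `Summit.BirchSwinnertonDyer.BirchSwinnertonDyer.…` repeats a namespace BY DESIGN.
set_option linter.dupNamespace false

noncomputable section

open scoped Classical

namespace Summit.BirchSwinnertonDyer.BirchSwinnertonDyer.Theorems.AdditiveBranchIMCTameRoadsMult

open WeierstrassCurve Literature.NumberTheory.EllipticCurves
  Literature.NumberTheory.EllipticCurves.Rank1Residual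
  Literature.NumberTheory.EllipticCurves.Rank1Residual.Typed

/-- **`BSD(A,p)` in analytic rank `0` from Skinner 2016 Thm. C, facts explicit.** At a prime `p ≥ 3`
that is good ordinary or multiplicative for `A/ℚ` (globally minimal model), with `A[p]` irreducible
and a multiplicative `ℓ ≠ p` at which `ρ̄_{A,p}` is ramified (`p ∤ v_ℓ(Δ_min)`), analytic rank `0`
gives Miller's `BSDp A p`: `L(A,1) ≠ 0` by modularity (`hmod`, `leadingLCoeff_ne_zero_holds`), `Ш(A)`
finite by Gross–Zagier–Kolyvagin (`hGZK`), Thm. C (`hSk`) is the rank-zero print shape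
`PPartRankZero A p`, and `bsdp_of_pPartRankZero` converts. [cite: Skinner2016PacificMC, Thm. C (§1)]
[cite: Miller2011LMS, Def. 1.1] -/
theorem bsdp_rankZero_of_thmC (hSk : Skinner2016.thmC_padicValRat_bsd_rank_zero)
    (hmod : hasEntireLFunction_rat) (hGZK : rank_eq_analyticRank_of_analyticRank_le_one)
    (A : WeierstrassCurve ℚ) [A.IsElliptic] [A.IsGloballyMinimal] (p : ℕ) [Fact p.Prime]
    (hp : 3 ≤ p) (hr : A.analyticRank = 0)
    (hred : (A.HasGoodReductionAtPrime p ∧ ¬ (p : ℤ) ∣ A.frobeniusTrace p) ∨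
      A.HasMultiplicativeReductionAtPrime p)
    (hirr : A.HasIrreducibleModPGaloisRep p)
    (hram : ∃ ℓ : ℕ, ∃ _ : Fact ℓ.Prime, ℓ ≠ p ∧ A.HasMultiplicativeReductionAtPrime ℓ ∧
      ¬ p ∣ padicValInt ℓ A.minimalDiscriminantInt) :
    BSDp A p := by
  have hfin : Finite A.sha := (hGZK A (by omega)).2
  have hL : A.entireLFunction 1 ≠ 0 := by
    rw [← A.leadingLCoeff_eq_of_analyticRank_eq_zero hr]
    exact A.leadingLCoeff_ne_zero_holds (hmod A)
  exact bsdp_of_pPartRankZero A p hmod hGZK hr (hSk A p hp hred hirr hram hL hfin)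

/-- **The multiplicative partner's `p`-part from Skinner 2016 Thm. C, facts explicit** (`MissingPPartAt`:
`#Ш_an(A)` is a rational `q` with `ord_p q = ord_p #Ш(A)`), at `p ≥ 3` good ordinary or multiplicative,
`A[p]` irreducible, (ram), analytic rank `0`: `bsdp_rankZero_of_thmC` read through
`missingPPartAt_of_bsdp` (`Ш(A)` finite by `hGZK`). [cite: Skinner2016PacificMC, Thm. C (§1)]
[cite: Miller2011LMS, Def. 1.1] -/
theorem missingPPartAt_rankZero_of_thmC (hSk : Skinner2016.thmC_padicValRat_bsd_rank_zero)
    (hmod : hasEntireLFunction_rat) (hGZK : rank_eq_analyticRank_of_analyticRank_le_one)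
    (A : WeierstrassCurve ℚ) [A.IsElliptic] [A.IsGloballyMinimal] (p : ℕ) [Fact p.Prime]
    (hp : 3 ≤ p) (hr : A.analyticRank = 0)
    (hred : (A.HasGoodReductionAtPrime p ∧ ¬ (p : ℤ) ∣ A.frobeniusTrace p) ∨
      A.HasMultiplicativeReductionAtPrime p)
    (hirr : A.HasIrreducibleModPGaloisRep p)
    (hram : ∃ ℓ : ℕ, ∃ _ : Fact ℓ.Prime, ℓ ≠ p ∧ A.HasMultiplicativeReductionAtPrime ℓ ∧
      ¬ p ∣ padicValInt ℓ A.minimalDiscriminantInt) :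
    MissingPPartAt A p := by
  haveI : Finite A.sha := (hGZK A (by omega)).2
  exact missingPPartAt_of_bsdp A p (bsdp_rankZero_of_thmC hSk hmod hGZK A p hp hr hred hirr hram)

/-- **The multiplicative partner's LOWER half from Skinner 2016 Thm. C, facts explicit** — the
conclusion of the registered stub `stub_partnerLowerSkinner` of line `tame_roads_mult` v3 with its
three named inputs displayed (`hSk`, modularity `hmod`, GZK `hGZK`) instead of the conjunction
`PrintedFactsM`, in the stub's own binders (`A` multiplicative at `p`, `ρ̄_{A,p}` onto ⟹ `A[p]`
irreducible by `hasIrreducibleModPGaloisRep_of_hasSurjectiveModNGaloisRep`; `5 ≤ p` only used as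
`3 ≤ p`): `MissingLowerBoundAt A p`, i.e. `ord_p #Ш_an(A) ≤ ord_p #Ш(A)` with `#Ш_an(A)` rational.
[cite: Skinner2016PacificMC, Thm. C (§1)] [cite: Miller2011LMS, Def. 1.1] -/
theorem missingLowerBoundAt_rankZero_mult_of_thmC (hSk : Skinner2016.thmC_padicValRat_bsd_rank_zero)
    (hmod : hasEntireLFunction_rat) (hGZK : rank_eq_analyticRank_of_analyticRank_le_one)
    (A : WeierstrassCurve ℚ) [A.IsElliptic] [A.IsGloballyMinimal] (p : ℕ) [Fact p.Prime]
    (hp : 5 ≤ p) (hr : A.analyticRank = 0) (hmult : A.HasMultiplicativeReductionAtPrime p)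
    (hsurj : Surj A p)
    (hram : ∃ ℓ : ℕ, ∃ _ : Fact ℓ.Prime, ℓ ≠ p ∧ A.HasMultiplicativeReductionAtPrime ℓ ∧
      ¬ p ∣ padicValInt ℓ A.minimalDiscriminantInt) :
    MissingLowerBoundAt A p :=
  (lower_and_upper_of_missingPPartAt A p
    (missingPPartAt_rankZero_of_thmC hSk hmod hGZK A p (by omega) hr (Or.inr hmult)
      (hasIrreducibleModPGaloisRep_of_hasSurjectiveModNGaloisRep A p hsurj) hram)).1

end Summit.BirchSwinnertonDyer.BirchSwinnertonDyer.Theorems.AdditiveBranchIMCTameRoadsMult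

end
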